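import Summits.QuantumFields.BalabanUV.T4Continuum.Spine.NE4.AutonomousScheme
import Literature.MathematicalPhysics.QuantumFieldTheory.Balaban1983to89.T4BetaStationary

/-!
# Spine/NE4/AutonomousSchemeCanonical — the CONVERSE of `AutonomousScheme` (census (R42)): every β-family with NE4's three shapes
# is, up to the geometric error `cθ^k∕(1−θ)`, the read-out of the CANONICAL θ-contracting Markov-state scheme «prepend the new coupling
# to the reversed history», with a read-out Lipschitz on the box histories — so node U2's hypothesis class IS «read-outs of θ-contracting
# autonomous schemes» up to geometric error

Cell `pub-balaban-gaps` (YM blitz G2), seat `ne4`, generation 9 (unit `pub-balaban-gaps-ne4-g9`); record `HOME/ne/NE4.md` §5 (R42), §17 (3).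
HONEST FRAMING as in `AutonomousScheme`: elementary bookkeeping on a weighted ℓ¹ pseudo-metric + (R17)'s continuum β-functional
`T4BetaStationary.betaInf` BY NAME; NE4 (`T4CouplingMatching.ScaleShiftRate`, NOT IN PRINT — [Balaban1987RG1] = CMP **109** p. 264) is NOT proved;
nothing of Bałaban's is asserted; no status word moves.  One finite T⁴; NOT ℝ⁴, NOT infinite volume, NOT a mass gap, NOT Clay.

CONTENT.  §1 `Hist θ` — reversed coupling histories (age `j ↦` coupling) with the pseudo-metric `dist h h′ = Σ_j θ^j·min 1 |h j − h′ j|`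
(`θ ∈ [0,1[` carried in the type); `Hist.cons g h` prepends a new coupling; `dist_cons_cons`: the prepend map contracts by EXACTLY `θ`;
`dist_cons_le`: it is `1`-Lipschitz in the coupling.  §2 THE CANONICAL SCHEME `canon θ g h = cons g h` from the constant bare history `const p`
has every shape of `AutonomousScheme` on the box histories `boxHists θ γ` (`invariant_canon`, `stateContraction_canon` — rate `θ`,
`stateCouplingLipschitz_canon` — `ℓ = 1`, `firstStep_canon` — `D = 1`); its states ARE the padded histories of `T4BetaStationary`
(`toFun_state_canon : (state (canon θ) (const p) (extd v) (k+1)).toFun = padHist p v`), so it REPRESENTS EXACTLY the stationary family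
`T4BetaStationary.ofFunctional B p` of ANY functional `B` (`representsAut_canon`), and a functional with (R17)'s `MemoryProfile Cm θ γ` is a
read-out Lipschitz ON the box histories with constant `Cm·max 1 γ` (`readLipschitzOn_canon`).  §3 THE CONVERSE: for `β` with
`ScaleShiftRate c θ γ β`, `HistLipschitz Λ γ β`, `FadingMemory Cm θ Λ` (`0 ≤ θ < 1`, padding `p ∈ ]0,γ]`), the canonical scheme read out by
`betaInf β` represents `ofFunctional (betaInf β) p` EXACTLY, with every `AutonomousScheme` shape, and `β` is `(c∕(1−θ))θ^k`-close to it on the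
boxes (`near_canonical`, by `T4BetaStationary.abs_beta_sub_betaInf_padHist_le` + `memoryProfile_betaInf`); the round trip through
`Markov.scaleShiftRate_of_markov` returns `ScaleShiftRate (Cm·max 1 γ·θ) θ γ (ofFunctional (betaInf β) p)` (`scaleShiftRate_canon_roundTrip`) —
(R17)'s `scaleShiftRate_roundTrip` in the autonomous currency; `exists_markov_of_ne4Shapes` packages the converse for a REAL rate
`0 ≤ θ < 1` as an existence statement (some θ-contracting Markov-state scheme represents exactly a family `cθ^k∕(1−θ)`-close to `β`).  So (R42)'s sufficient mechanism is also NECESSARY up to geometric error: at node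
U2, the input triple «NE4 + history moduli with fading memory» IMPLIES `cθ^k∕(1−θ)`-proximity to a family EXACTLY represented by a θ-contracting Markov-state
scheme with a read-out Lipschitz on its invariant set, and exact representation implies the triple back (file A).  PRECISELY: the two classes coincide
at the level of NE4 proper (`ScaleShiftRate` is stable under `c′θ^k`-perturbations — `T4BetaStationary.scaleShiftRate_of_near_ofFunctional`), while the
Lipschitz moduli distinguish exact representation from mere proximity (they are NOT stable under such perturbations).  Nothing here touches Bałaban's
objects: WHICH state space realises his RT is NODE O's question (census §6).
-/

namespace Summit.QuantumFields.BalabanUV.T4Continuum.Spine.NE4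

open Literature.MathematicalPhysics.QuantumFieldTheory.Balaban1983to89
open Literature.MathematicalPhysics.QuantumFieldTheory.Balaban1983to89.FlowStep
open Literature.MathematicalPhysics.QuantumFieldTheory.Balaban1983to89.T4CouplingMatching
  (ScaleShiftRate HistLipschitz FadingMemory)
open Literature.MathematicalPhysics.QuantumFieldTheory.Balaban1983to89.T4FlagMemory (extd extd_coe extd_adm Adm)
open Literature.MathematicalPhysics.QuantumFieldTheory.Balaban1983to89.T4BetaStationary
  (SeqBox padHist padHist_of_le padHist_of_lt padHist_seqBox MemoryProfile betaInf ofFunctional memoryProfile_betaInf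
    abs_beta_sub_betaInf_padHist_le constant_nonneg_of_fadingMemory)
open scoped BigOperators

namespace Markov

/-! ## §1 Reversed histories with the θ-weighted truncated ℓ¹ pseudo-metric; the prepend map contracts by exactly θ -/

/-- REVERSED COUPLING HISTORIES (`toFun 0` = the newest coupling, `toFun j` = the coupling of age `j`) for a rate `θ ∈ [0,1[` carried in the
type, to be metrised by `Σ_j θ^j·min 1 |h j − h′ j|`. [folklore] -/
structure Hist (θ : Set.Ico (0:ℝ) 1) where
  /-- age ↦ coupling -/
  toFun : ℕ → ℝ

namespace Hist

variable {θ : Set.Ico (0:ℝ) 1}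

/-- [bookkeeping] `0 ≤ θ`. [folklore] -/
theorem rate_nonneg (θ : Set.Ico (0:ℝ) 1) : 0 ≤ (θ : ℝ) := θ.2.1

/-- [bookkeeping] `θ < 1`. [folklore] -/
theorem rate_lt_one (θ : Set.Ico (0:ℝ) 1) : (θ : ℝ) < 1 := θ.2.2

/-- The summand of the pseudo-metric: `θ^j·min 1 |h j − h′ j|`. [folklore] -/
noncomputable def term (h h' : Hist θ) (j : ℕ) : ℝ := (θ : ℝ) ^ j * min 1 |h.toFun j - h'.toFun j|

/-- [bookkeeping] summands are non-negative. [folklore] -/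
theorem term_nonneg (h h' : Hist θ) (j : ℕ) : 0 ≤ term h h' j :=
  mul_nonneg (pow_nonneg (rate_nonneg θ) j) (le_min zero_le_one (abs_nonneg _))

/-- [bookkeeping] summands are dominated by the geometric sequence. [folklore] -/
theorem term_le (h h' : Hist θ) (j : ℕ) : term h h' j ≤ (θ : ℝ) ^ j :=
  (mul_le_mul_of_nonneg_left (min_le_left _ _) (pow_nonneg (rate_nonneg θ) j)).trans (by rw [mul_one])

/-- [bookkeeping] the pseudo-metric series converges. [folklore] -/
theorem summable_term (h h' : Hist θ) : Summable (term h h') :=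
  Summable.of_nonneg_of_le (term_nonneg h h') (term_le h h') (summable_geometric_of_lt_one (rate_nonneg θ) (rate_lt_one θ))

/-- [bookkeeping] diagonal summands vanish. [folklore] -/
theorem term_self (h : Hist θ) (j : ℕ) : term h h j = 0 := by simp [term]

/-- [bookkeeping] summands are symmetric. [folklore] -/
theorem term_comm (h h' : Hist θ) (j : ℕ) : term h h' j = term h' h j := by
  simp only [term, abs_sub_comm]

/-- [bookkeeping] summands satisfy the triangle inequality (the truncation `min 1` is subadditive). [folklore] -/
theorem term_triangle (h h' h'' : Hist θ) (j : ℕ) : term h h'' j ≤ term h h' j + term h' h'' j := by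
  simp only [term, ← mul_add]
  refine mul_le_mul_of_nonneg_left ?_ (pow_nonneg (rate_nonneg θ) j)
  have htri : |h.toFun j - h''.toFun j| ≤ |h.toFun j - h'.toFun j| + |h'.toFun j - h''.toFun j| := abs_sub_le _ _ _
  rcases le_total 1 |h.toFun j - h'.toFun j| with h1 | h1
  · calc min 1 |h.toFun j - h''.toFun j| ≤ 1 := min_le_left _ _
      _ = min 1 |h.toFun j - h'.toFun j| := (min_eq_left h1).symm
      _ ≤ _ := le_add_of_nonneg_right (le_min zero_le_one (abs_nonneg _))
  rcases le_total 1 |h'.toFun j - h''.toFun j| with h2 | h2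
  · calc min 1 |h.toFun j - h''.toFun j| ≤ 1 := min_le_left _ _
      _ = min 1 |h'.toFun j - h''.toFun j| := (min_eq_left h2).symm
      _ ≤ _ := le_add_of_nonneg_left (le_min zero_le_one (abs_nonneg _))
  rw [min_eq_right h1, min_eq_right h2]
  exact (min_le_right _ _).trans htri

/-- THE θ-WEIGHTED TRUNCATED ℓ¹ PSEUDO-METRIC on reversed histories: `dist h h′ = Σ'_j θ^j·min 1 |h j − h′ j|`. [folklore] -/
noncomputable instance : PseudoMetricSpace (Hist θ) where
  dist h h' := ∑' j, term h h' j
  dist_self h := by simp [term_self]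
  dist_comm h h' := by simp only [term_comm]
  dist_triangle h h' h'' := by
    calc ∑' j, term h h'' j ≤ ∑' j, (term h h' j + term h' h'' j) :=
          Summable.tsum_le_tsum (term_triangle h h' h'') (summable_term _ _) ((summable_term _ _).add (summable_term _ _))
      _ = ∑' j, term h h' j + ∑' j, term h' h'' j := Summable.tsum_add (summable_term _ _) (summable_term _ _)

/-- [bookkeeping] unfolding of the distance. [folklore] -/
theorem dist_def (h h' : Hist θ) : dist h h' = ∑' j, term h h' j := rfl

/-- PREPEND a new coupling: the new history has the coupling `g` at age `0` and the old couplings one age older. [folklore] -/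
def cons (g : ℝ) (h : Hist θ) : Hist θ := ⟨fun j => Nat.casesOn j g h.toFun⟩

/-- [bookkeeping] age `0` of the prepended history. [folklore] -/
@[simp] theorem cons_zero (g : ℝ) (h : Hist θ) : (cons g h).toFun 0 = g := rfl

/-- [bookkeeping] positive ages of the prepended history. [folklore] -/
@[simp] theorem cons_succ (g : ℝ) (h : Hist θ) (j : ℕ) : (cons g h).toFun (j + 1) = h.toFun j := rfl

/-- **THE PREPEND MAP CONTRACTS BY EXACTLY θ** at a fixed new coupling: `dist (cons g h) (cons g h′) = θ·dist h h′`. [folklore] -/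
theorem dist_cons_cons (g : ℝ) (h h' : Hist θ) : dist (cons g h) (cons g h') = (θ : ℝ) * dist h h' := by
  rw [dist_def, dist_def, (summable_term _ _).tsum_eq_zero_add]
  have h0 : term (cons g h) (cons g h') 0 = 0 := by simp [term]
  have hs : ∀ j, term (cons g h) (cons g h') (j + 1) = (θ : ℝ) * term h h' j := fun j => by
    simp only [term, cons_succ, pow_succ]; ring
  rw [h0, zero_add]
  simp only [hs]
  exact (summable_term h h').tsum_mul_left (θ : ℝ)

/-- The prepend map is `1`-Lipschitz in the new coupling: `dist (cons g h) (cons g′ h) = min 1 |g − g′| ≤ |g − g′|`. [folklore] -/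
theorem dist_cons_le (g g' : ℝ) (h : Hist θ) : dist (cons g h) (cons g' h) ≤ |g - g'| := by
  rw [dist_def, (summable_term _ _).tsum_eq_zero_add]
  have hs : ∀ j, term (cons g h) (cons g' h) (j + 1) = 0 := fun j => by simp [term]
  have h0 : term (cons g h) (cons g' h) 0 = min 1 |g - g'| := by simp [term]
  rw [h0, tsum_congr hs, tsum_zero, add_zero]
  exact min_le_right _ _

/-- The constant history (the bare state of the canonical scheme). [folklore] -/
def const (θ : Set.Ico (0:ℝ) 1) (p : ℝ) : Hist θ := ⟨fun _ => p⟩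

/-- [bookkeeping] The first prepend moves the constant history by `min 1 |g − p| ≤ 1`. [folklore] -/
theorem dist_cons_const_le (g p : ℝ) : dist (cons g (const θ p)) (const θ p) ≤ 1 := by
  rw [dist_def, (summable_term _ _).tsum_eq_zero_add]
  have hs : ∀ j, term (cons g (const θ p)) (const θ p) (j + 1) = 0 := fun j => by simp [term, const]
  have h0 : term (cons g (const θ p)) (const θ p) 0 = min 1 |g - p| := by simp [term, const]
  rw [h0, tsum_congr hs, tsum_zero, add_zero]
  exact min_le_left _ _

/-- [bookkeeping] On box-valued histories the truncated distance dominates the profile of `T4BetaStationary.MemoryProfile`: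
`Σ' θ^j |h j − h′ j| ≤ max 1 γ · dist h h′` (entrywise `|x| ≤ max 1 γ · min 1 |x|` when `|x| ≤ γ`). [folklore] -/
theorem tsum_profile_le_dist {γ : ℝ} {h h' : Hist θ} (hh : SeqBox γ h.toFun) (hh' : SeqBox γ h'.toFun) :
    ∑' j, (θ : ℝ) ^ j * |h.toFun j - h'.toFun j| ≤ max 1 γ * dist h h' := by
  rw [dist_def, ← tsum_mul_left]
  have hptw : ∀ j, (θ : ℝ) ^ j * |h.toFun j - h'.toFun j| ≤ max 1 γ * term h h' j := by
    intro j
    have hx : |h.toFun j - h'.toFun j| ≤ γ := by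
      rw [abs_sub_le_iff]; constructor <;> linarith [(hh j).1, (hh j).2, (hh' j).1, (hh' j).2]
    have key : |h.toFun j - h'.toFun j| ≤ max 1 γ * min 1 |h.toFun j - h'.toFun j| := by
      rcases le_total |h.toFun j - h'.toFun j| 1 with h1 | h1
      · rw [min_eq_right h1]
        exact le_mul_of_one_le_left (abs_nonneg _) (le_max_left _ _)
      · rw [min_eq_left h1, mul_one]
        exact hx.trans (le_max_right _ _)
    calc (θ : ℝ) ^ j * |h.toFun j - h'.toFun j| ≤ (θ : ℝ) ^ j * (max 1 γ * min 1 |h.toFun j - h'.toFun j|) :=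
          mul_le_mul_of_nonneg_left key (pow_nonneg (rate_nonneg θ) j)
      _ = max 1 γ * term h h' j := by simp only [term]; ring
  have hsum : Summable fun j => (θ : ℝ) ^ j * |h.toFun j - h'.toFun j| := by
    refine Summable.of_nonneg_of_le (fun j => mul_nonneg (pow_nonneg (rate_nonneg θ) j) (abs_nonneg _)) hptw ?_
    exact (summable_term h h').mul_left _
  exact Summable.tsum_le_tsum hptw hsum ((summable_term h h').mul_left _)

end Hist

/-! ## §2 The canonical scheme: every `AutonomousScheme` shape, states = padded histories, exact representation of stationary families -/

section Canon

variable {θ : Set.Ico (0:ℝ) 1}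

/-- THE CANONICAL AUTONOMOUS SCHEME on reversed histories: one step = prepend the step's coupling. [folklore] -/
def canon (θ : Set.Ico (0:ℝ) 1) : ℝ → Hist θ → Hist θ := fun g h => Hist.cons g h

/-- The box-valued histories: the canonical invariant set. [folklore] -/
def boxHists (θ : Set.Ico (0:ℝ) 1) (γ : ℝ) : Set (Hist θ) := {h | SeqBox γ h.toFun}

/-- [bookkeeping] a constant history with value in ]0,γ] is box-valued. [folklore] -/
theorem const_mem_boxHists {γ p : ℝ} (hp0 : 0 < p) (hpγ : p ≤ γ) : Hist.const θ p ∈ boxHists θ γ := fun _ => ⟨hp0, hpγ⟩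

/-- The box histories are invariant under admissible prepends. [folklore] -/
theorem invariant_canon (γ : ℝ) : Invariant (canon θ) (boxHists θ γ) γ := by
  intro g hg0 hgγ h hh j
  rcases j with _ | j
  · exact ⟨hg0, hgγ⟩
  · exact hh j

/-- The canonical scheme CONTRACTS BY θ (indeed with equality, on all of `Hist θ`). [folklore] -/
theorem stateContraction_canon (γ : ℝ) : StateContraction (canon θ) (boxHists θ γ) (θ : ℝ) γ :=
  fun g _ _ h _ h' _ => (Hist.dist_cons_cons g h h').le

/-- The canonical scheme is `1`-Lipschitz in the coupling. [folklore] -/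
theorem stateCouplingLipschitz_canon (γ : ℝ) : StateCouplingLipschitz (canon θ) (boxHists θ γ) 1 γ :=
  fun g g' _ _ _ _ h _ => by rw [one_mul]; exact Hist.dist_cons_le g g' h

/-- The first step of the canonical scheme from a constant history moves it by at most `1`. [folklore] -/
theorem firstStep_canon (γ p : ℝ) : FirstStep (canon θ) (Hist.const θ p) 1 γ :=
  fun g _ _ => Hist.dist_cons_const_le g p

/-- [bookkeeping] THE STATES OF THE CANONICAL SCHEME ARE THE PADDED HISTORIES of `T4BetaStationary`: after `j` prepends along `g` from
`const p`, age `i < j` holds `g (j − 1 − i)` and older ages hold `p`. [folklore] -/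
theorem toFun_state_canon (p : ℝ) (g : ℕ → ℝ) :
    ∀ j i, (state (canon θ) (Hist.const θ p) g j).toFun i = if i < j then g (j - 1 - i) else p := by
  intro j
  induction j with
  | zero => intro i; simp [Hist.const]
  | succ j ih =>
    intro i
    rw [state_succ]
    rcases i with _ | i
    · simp [canon]
    · simp only [canon, Hist.cons_succ, ih i]
      by_cases hi : i < j
      · rw [if_pos hi, if_pos (by omega), show j + 1 - 1 - (i + 1) = j - 1 - i by omega]
      · rw [if_neg hi, if_neg (by omega)]

/-- [bookkeeping] Along the extension of a finite history `v = (g_0,…,g_k)`, the state after `k + 1` prepends IS `padHist p v`. [folklore] -/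
theorem toFun_state_canon_extd (p : ℝ) {k : ℕ} (v : Fin (k + 1) → ℝ) :
    (state (canon θ) (Hist.const θ p) (extd v) (k + 1)).toFun = padHist p v := by
  funext i
  rw [toFun_state_canon]
  by_cases hi : i ≤ k
  · rw [if_pos (by omega), padHist_of_le p v hi, show k + 1 - 1 - i = k - i by omega]
    have hki : k - i ≤ k := Nat.sub_le k i
    simp only [extd, hki, dif_pos]
  · rw [if_neg (by omega), padHist_of_lt p v (by omega)]

/-- **EXACT REPRESENTATION OF EVERY STATIONARY FAMILY**: the canonical scheme read out by `h ↦ B h.toFun` from the constant history `p`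
represents `T4BetaStationary.ofFunctional B p` EXACTLY (`RepresentsAut`), for ANY functional `B`. [folklore] -/
theorem representsAut_canon (B : (ℕ → ℝ) → ℝ) (p γ : ℝ) :
    RepresentsAut (canon θ) (fun h : Hist θ => B h.toFun) (Hist.const θ p) γ (ofFunctional B p) := by
  intro k v _
  show B (padHist p v) = B _
  rw [toFun_state_canon_extd]

/-- **A FUNCTIONAL WITH (R17)'s MEMORY PROFILE IS A READ-OUT LIPSCHITZ ON THE BOX HISTORIES**, constant `Cm·max 1 γ`
(`Hist.tsum_profile_le_dist`). [folklore] -/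
theorem readLipschitzOn_canon {B : (ℕ → ℝ) → ℝ} {Cm γ : ℝ} (hB : MemoryProfile Cm (θ : ℝ) γ B) (hCm : 0 ≤ Cm) :
    ReadLipschitzOn (fun h : Hist θ => B h.toFun) (boxHists θ γ) (Cm * max 1 γ) := by
  intro h hh h' hh'
  calc |B h.toFun - B h'.toFun| ≤ Cm * ∑' j, (θ : ℝ) ^ j * |h.toFun j - h'.toFun j| := hB _ _ hh hh'
    _ ≤ Cm * (max 1 γ * dist h h') := mul_le_mul_of_nonneg_left (Hist.tsum_profile_le_dist hh hh') hCm
    _ = Cm * max 1 γ * dist h h' := by ring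

end Canon

/-! ## §3 The converse: NE4's three shapes ⇒ geometric proximity to the read-out of the canonical θ-contracting scheme -/

section Converse

variable {θ : Set.Ico (0:ℝ) 1} {β : HBeta} {Λ : ℕ → ℕ → ℝ} {c Cm γ p : ℝ}

/-- **THE CONVERSE OF `AutonomousScheme` (up to geometric error).**  If `β` has node U2's three shapes — `ScaleShiftRate c θ γ β`,
`HistLipschitz Λ γ β`, `FadingMemory Cm θ Λ` — then for any padding value `p ∈ ]0,γ]` the CANONICAL scheme `canon θ` from `const p`, read out
by (R17)'s continuum β-functional `betaInf β`, (i) has every shape of `AutonomousScheme` on the box histories (invariant set containing the bare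
state; contraction rate `θ`; coupling constant `1`; first step `1`; read-out constant `Cm·max 1 γ`), (ii) represents the stationary family
`ofFunctional (betaInf β) p` EXACTLY, and (iii) `β` is `cθ^k∕(1−θ)`-close to that family on the boxes.  So the input triple «NE4 + history moduli
with fading memory» implies geometric proximity to the read-out of a θ-contracting Markov-state scheme, and (file A) exact representation by such a
scheme implies the triple: the autonomous reading is necessary as well as sufficient, up to the error `cθ^k∕(1−θ)` — under which `ScaleShiftRate` (NE4
proper) is stable and the Lipschitz moduli are not ((R17)'s round trip in the autonomous currency).  Elementary; BY NAME on `T4BetaStationary`. [folklore] -/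
theorem near_canonical (hss : ScaleShiftRate c (θ : ℝ) γ β) (hL : HistLipschitz Λ γ β) (hF : FadingMemory Cm (θ : ℝ) Λ)
    (hp0 : 0 < p) (hpγ : p ≤ γ) :
    (Invariant (canon θ) (boxHists θ γ) γ ∧ Hist.const θ p ∈ boxHists θ γ ∧
      StateContraction (canon θ) (boxHists θ γ) (θ : ℝ) γ ∧ StateCouplingLipschitz (canon θ) (boxHists θ γ) 1 γ ∧
      FirstStep (canon θ) (Hist.const θ p) 1 γ ∧
      ReadLipschitzOn (fun h : Hist θ => betaInf β h.toFun) (boxHists θ γ) (Cm * max 1 γ)) ∧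
    RepresentsAut (canon θ) (fun h : Hist θ => betaInf β h.toFun) (Hist.const θ p) γ (ofFunctional (betaInf β) p) ∧
    ∀ k (v : Fin (k + 1) → ℝ), v ∈ Box γ k → |β k v - ofFunctional (betaInf β) p k v| ≤ c * (θ : ℝ) ^ k / (1 - (θ : ℝ)) := by
  refine ⟨⟨invariant_canon γ, const_mem_boxHists hp0 hpγ, stateContraction_canon γ, stateCouplingLipschitz_canon γ,
    firstStep_canon γ p, readLipschitzOn_canon (memoryProfile_betaInf hss hL hF (Hist.rate_nonneg θ) (Hist.rate_lt_one θ))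
      (constant_nonneg_of_fadingMemory hF)⟩, representsAut_canon _ p γ, fun k v hv => ?_⟩
  show |β k v - betaInf β (padHist p v)| ≤ _
  exact abs_beta_sub_betaInf_padHist_le hss (Hist.rate_lt_one θ) hp0 hpγ hv

/-- **THE ROUND TRIP THROUGH `Markov.scaleShiftRate_of_markov`**: the canonical data of `near_canonical` fed back into the autonomous theorem
return `ScaleShiftRate (Cm·max 1 γ·θ) θ γ (ofFunctional (betaInf β) p)` for the stationary family — compare (R17)'s
`T4BetaStationary.scaleShiftRate_ofFunctional` (constant `Cm·γ·θ`).  The hypothesis CLASS is stable; only constants move. [folklore] -/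
theorem scaleShiftRate_canon_roundTrip (hss : ScaleShiftRate c (θ : ℝ) γ β) (hL : HistLipschitz Λ γ β)
    (hF : FadingMemory Cm (θ : ℝ) Λ) (hp0 : 0 < p) (hpγ : p ≤ γ) :
    ScaleShiftRate (Cm * max 1 γ * 1 * (θ : ℝ)) (θ : ℝ) γ (ofFunctional (betaInf β) p) := by
  obtain ⟨⟨hInv, hξ, hcon, _, hfirst, hr⟩, hrep, _⟩ := near_canonical hss hL hF hp0 hpγ
  have hCm : 0 ≤ Cm * max 1 γ := mul_nonneg (constant_nonneg_of_fadingMemory hF) (le_trans zero_le_one (le_max_left _ _))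
  exact scaleShiftRate_of_markov (Hist.rate_nonneg θ) hCm hInv hξ hcon hfirst hrep hr

/-- **THE CONVERSE WITH A REAL RATE, PACKAGED**: for `0 ≤ θ < 1`, a β-family with NE4's three shapes ADMITS a θ-contracting Markov-state scheme (some
pseudo-metric state space, one-step map, invariant set containing the bare state, read-out Lipschitz on it — constants `ℓ = 1`, `D = 1`, `cr = Cm·max 1 γ`)
representing EXACTLY a family that is `cθ^k∕(1−θ)`-close to `β` on the boxes.  Witness: the canonical scheme on `Hist ⟨θ, _⟩`. [folklore] -/
theorem exists_markov_of_ne4Shapes {θ : ℝ} (hθ0 : 0 ≤ θ) (hθ1 : θ < 1) (hss : ScaleShiftRate c θ γ β) (hL : HistLipschitz Λ γ β)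
    (hF : FadingMemory Cm θ Λ) (hp0 : 0 < p) (hpγ : p ≤ γ) :
    ∃ (X : Type) (_ : PseudoMetricSpace X) (A : ℝ → X → X) (S : Set X) (ξ : X) (r : X → ℝ) (β' : HBeta),
      Invariant A S γ ∧ ξ ∈ S ∧ StateContraction A S θ γ ∧ StateCouplingLipschitz A S 1 γ ∧ FirstStep A ξ 1 γ ∧
      ReadLipschitzOn r S (Cm * max 1 γ) ∧ RepresentsAut A r ξ γ β' ∧
      ∀ k (v : Fin (k + 1) → ℝ), v ∈ Box γ k → |β k v - β' k v| ≤ c * θ ^ k / (1 - θ) := by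
  obtain ⟨⟨h1, h2, h3, h4, h5, h6⟩, h7, h8⟩ :=
    near_canonical (θ := ⟨θ, hθ0, hθ1⟩) (β := β) (Λ := Λ) (c := c) (Cm := Cm) (γ := γ) (p := p) hss hL hF hp0 hpγ
  exact ⟨Hist ⟨θ, hθ0, hθ1⟩, inferInstance, canon _, boxHists _ γ, Hist.const _ p, fun h => betaInf β h.toFun,
    ofFunctional (betaInf β) p, h1, h2, h3, h4, h5, h6, h7, h8⟩

end Converse

end Markov

end Summit.QuantumFields.BalabanUV.T4Continuum.Spine.NE4
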